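import Summits.ResolutionOfSingularities.ResolutionOfSingularities.Theorems.ExitCutKernels2
import Summits.ResolutionOfSingularities.ResolutionOfSingularities.Theorems.CrossCutCells
import Summits.ResolutionOfSingularities.ResolutionOfSingularities.Theorems.RelativeDeltaCutClasses
import Literature.AlgebraicGeometry.Resolution.HironakaTauTransport
import Literature.AlgebraicGeometry.Resolution.DiffIdealStalk
import Literature.AlgebraicGeometry.Resolution.DiffIdealSupportOrder
import Literature.AlgebraicGeometry.Resolution.SharpOrderCoordinateCentre
import Literature.AlgebraicGeometry.Resolution.RegularBlowup
import Literature.AlgebraicGeometry.Resolution.RegularCentreBlowupOrder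
import Literature.AlgebraicGeometry.Resolution.SubschemeRegularStalks
import Literature.AlgebraicGeometry.Resolution.PermissibleCentres
import Literature.AlgebraicGeometry.Resolution.MarkedIdealPointBlowup
import Literature.AlgebraicGeometry.Resolution.BlowupOffCentre
import Literature.AlgebraicGeometry.Resolution.BlowupsFlatBaseChange
import Literature.AlgebraicGeometry.Resolution.BlowupSequencesRestrictMarked
import Literature.AlgebraicGeometry.Resolution.BlowupSequencesExtendOpen
import Literature.AlgebraicGeometry.Resolution.BlowupSequencesExtensions
import Literature.AlgebraicGeometry.Resolution.BlowupSequencesOffCentres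
import Literature.AlgebraicGeometry.Resolution.BlowupSequencesAppend
import Literature.AlgebraicGeometry.Resolution.MarkedIdealsLemmas
import Literature.AlgebraicGeometry.Resolution.MarkedIdealsRestrict
import Literature.AlgebraicGeometry.Resolution.SigmaMaxEliminationInDim
import Literature.AlgebraicGeometry.Resolution.Hironaka2005CompletionOrders
import Literature.AlgebraicGeometry.Resolution.OrderSemicontinuityPointwise
import Literature.AlgebraicGeometry.Resolution.KollarEtaleEquivalenceIndep
import Literature.AlgebraicGeometry.Resolution.IdealSheafDescent
import Literature.AlgebraicGeometry.Resolution.AlterationsNodalBoundary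
import HarnessLib

/-!
# ExitCutTransport — decomp-res node «PortCut» (lens-2 g28, critic row 219 CLEARED · MAP +1 ONCE (D1: the multi-unit
port proved for every n)), tree file 1/5 of the node

Content VERBATIM from the decomp-res lens-2 g28 node `HOME/decomp-res-lens-2/g28/PortCut.lean` (pin 67bf9bb7 = PIN
STATUS :1923, 817 l; HOME = run/shared/lean/pub/decomp-res): NO carry — the node imports the LANDED tree only
(`Theorems.MaxContactCutExitCut` = the g27 node «ExitCut», twenty-four `Literature.AlgebraicGeometry.Resolution.*`
modules, `HarnessLib`); every declaration is new except the display corollary `closes` (cited, not re-landed — see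
the last file); namespace `…Theses.PortCut` ↦ `…Theorems.PortCut` (same renaming as ExitCut / CuspCut / FaceCut;
decl names kept; the node's dupNamespace-linter line — needed only under the Theses-style namespace — dropped).
Farm (node; lens + critic runs): rc 0 · 0 err · 0 warn · 0 sorry; axioms std (propext / Classical.choice /
Quot.sound); no `native_decide`, no `allowUnsafeReducibility`; HOME audit def 1 / proof.conditional 2 (the two
display corollaries) / support 28, no orphan, no vendored fact.  Critic: CRITIC-LEDGER row 219 (l.294) «PortCut»
CLEARED, MAP +1 ONCE (D1 = THE door of row 212, the LAST payment on the port family; conditions (m1)–(m8) met), tree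
currency: THE MULTI-UNIT PORT IN KERNEL — **`componentPackagePort_holds (n) : CrossCut.ComponentPackagePort n` for
EVERY `n`**, hypothesis-free, on the landed definition VERBATIM (no twin), through g27's typed residual
**`multiUnitPackageTransport_holds (n) : ExitCut.MultiUnitPackageTransport n`** (every `n`) and the landed kernel
`ExitCut.componentPackagePort_of_multiUnitPackageTransport`: transport along a local isomorphism (`IsIso (f.stalkMap
x)` + the stalk relation) of order / Hironaka's τ / maximal contact / `ClassGE` (`idealOrder_eq_of_isIso_stalkMap`,
`tauAt_eq_of_isIso_stalkMap`, `isContactPt_of_isIso_stalkMap`, `classGE_of_isIso_stalkMap`); sequence kernels for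
`CentreSeq` under `WeakAdmissible` (regular top, order persistence, stalks of the transform off the centres,
`WeakAdmissible.restrict`, EXTENSION from an open over a closed set `exists_extend_weak`); PACKAGE UNITS
(`PackageUnit`; each of the four unit-exit kinds puts the point on a unit; finitely many units cover the
non-class-≥-2 top points `exists_finset_units`); THE PORT `exists_unit_transport` + the induction on the number of
units `transport_kernel` / `transport_conclusion`; the binders `hP : ∀ n ≥ 2, ComponentPackagePort n` of the landed
wirings `ExitCut.cuspGenericRung_of_ports` / `ExitCut.closes_of_engines` DISCHARGED by name
(`cuspGenericRung_of_engines`, `closes_of_engines`: `CuspX.CuspGenericRung` is now DECIDED MOD exactly the eighteen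
engine letters).  LENS-2 WINDOW g29 (binding, in the row): port family CLOSED in every currency.  Landing orders =
the lens LANDING NOTE INBOX :1549 endorsed by the critic rider INBOX 2026-08-31T12:16:46Z: (Y1) `ExitCutTransport` =
§T `section Transport` + §S `section Seq`, (Y2) `MaxContactCutPort` = §U `section Units` + §P `section Port` + §C
`section Kernel`, (Y3) `MaxContactCutPortCut` = `section Corollaries` (the only declarations touching the
`Theses.MaxContactCut` wiring; imports Y2 + the landed `MaxContactCutExitCut`); Y1/Y2 import the node's imports with
the cone wiring file replaced by its cone-free kernel end `ExitCutKernels2` plus the cone-free homes of the port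
vocabulary (`CrossCutCells`, `RelativeDeltaCutClasses`), so no cone-free file reaches `Theses`; all VERBATIM,
`--kind proof --supports stmt-ResolutionOfSingularities-29273`; NO aside switch (33866 `LeafSpecialRung` unchanged);
`bc/Probe.lean` stays HOME.  `structure PackageUnit` is a data-carrying record (not a Prop-valued letter); the node
declares no `def … : Prop`.

The lens header, verbatim:

> # PortCut — g28 · RESIDUAL MODE node of `decomp-res-lens-2` (structural dichotomy, special vs generic)
>
> Column target BY NAME: `MaxContactCut.RungOne` (stmt-29273) through the landed `CuspX.closes :
> CuspX.CuspGenericRung → CuspX.CuspSpecialRung → MaxContactCut.RungOne`.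
>
> THE MAP DOOR OF g28 (critic row 212): the multi-unit PORT of the generic half — the landed definition
> `CrossCut.ComponentPackagePort n` (`Theorems/CrossCutCells.lean`) VERBATIM, no twin — is PROVED in the kernel,
> hypothesis-free, for EVERY `n` (`componentPackagePort_holds`) — through g27's typed residual
> `ExitCut.MultiUnitPackageTransport n`, itself PROVED for every `n` (`multiUnitPackageTransport_holds`), and the landed
> kernel `ExitCut.componentPackagePort_of_multiUnitPackageTransport` — and the binders `hP : ∀ n ≥ 2, ComponentPackagePort n`
> of the landed wirings `ExitCut.cuspGenericRung_of_ports` / `ExitCut.closes_of_engines` (g27: `h1 : OrderOneContact` already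
> discharged there) are DISCHARGED (`cuspGenericRung_of_engines`, `closes_of_engines`; `closes` by name).  See
`NODE-g28.md` for the frame paragraph,
> the residual letters and the probe table.
>
> ## Layout
>
> * (g27 «ExitCut» is LANDED — `Theorems/ExitCutKernels{,2}.lean`, `Theorems/MaxContactCutExitCut.lean`, namespace
>   `…Theorems.ExitCut` — and is IMPORTED, nothing carried: `ExitCut.kStr`, `ExitCut.isContactPt_iff_exists_stalk`,
>   `ExitCut.weakResolution_append`, `ExitCut.orderOneContact_holds`, `ExitCut.cuspGenericRung_of_ports`,
>   `ExitCut.closes_of_engines`, `ExitCut.MultiUnitPackageTransport` are used BY NAME);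
> * §T  TRANSPORT ALONG A LOCAL ISOMORPHISM (`IsIso (f.stalkMap x)` + the stalk relation): order, Hironaka's `τ`
>       (`tauAt`), maximal contact (`IsContactPt`, composite `k`-structure `f ≫ g`), hence `ClassGE`;
> * §S  SEQUENCE KERNELS for the tree's `CentreSeq` under `WeakAdmissible` (the snc-free twin of the tree's
>       `IsAdmissibleFor` API, proofs re-run with the tree's ingredient lemmas BY NAME): regular top, order `≤ μ`
>       persistence, the stalk of the transform OFF the set the centres lie over, restriction to an open
>       (`WeakAdmissible.restrict`), EXTENSION from an open over a closed set (`exists_extend_weak`), the package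
>       property under restriction / extension (concatenation is the landed `ExitCut.weakResolution_append`);
> * §U  PACKAGE UNITS (`PackageUnit`, bundled: a closed, open-in-Top set of top points carrying
>       `PackageExitsOver`): each of the four unit-exit kinds of the port's letter puts the point on a unit; FINITELY
>       MANY units cover the non-class-≥-2 top points (noetherian compactness + open-in-Top);
> * §P  THE PORT: transport of a unit through the package of another unit (`exists_unit_transport`: restrict the
>       package to `Y ∖ T`, where the composite is an isomorphism, and extend it over the closed `T' ∖ T`), and the
>       induction on the number of units (`transport_kernel`, concatenation bookkeeping `transport_conclusion`);
> * §C  `multiUnitPackageTransport_holds` (g27's typed residual, all `n`), `componentPackagePort_holds` (all `n`, via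
>       the landed `ExitCut.componentPackagePort_of_multiUnitPackageTransport`), the by-name corollaries, `closes`.

## This file

§T `section Transport` — TRANSPORT ALONG A LOCAL ISOMORPHISM: `idealOrder_eq_of_isIso_stalkMap`,
`tauAt_eq_of_isIso_stalkMap`, `isContactPt_of_isIso_stalkMap`, `classGE_of_isIso_stalkMap`; §S `section Seq` —
SEQUENCE KERNELS for `CentreSeq` under `WeakAdmissible`: `weakAdmissible_cons`, `isRegular_top_of_weakAdmissible`,
`idealOrder_controlledTransform_blowup_le`, `idealOrder_transformMarked_le`,
`stalkIdeal_transformMarked_of_not_mem`, `stalkIdeal_transformMarked_eq_map_of_not_mem`,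
`comap_transformMarked_of_forall_not_mem`, `WeakAdmissible.restrict`, `exists_extend_weak`, `restrict_pointwise`,
`tauTwo_restrict`, `tauTwo_of_isPullbackAlong`.  (The 400-line cap cuts this group into 2 files; this first part
carries: `idealOrder_eq_of_isIso_stalkMap`, `tauAt_eq_of_isIso_stalkMap`, `isContactPt_of_isIso_stalkMap`,
`classGE_of_isIso_stalkMap`, `weakAdmissible_cons`, `isRegular_top_of_weakAdmissible`,
`idealOrder_controlledTransform_blowup_le`, `idealOrder_transformMarked_le`,
`stalkIdeal_transformMarked_of_not_mem`, `stalkIdeal_transformMarked_eq_map_of_not_mem`,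
`comap_transformMarked_of_forall_not_mem`, `WeakAdmissible.restrict`.)

[WRITER NOTE (decomp-res writer g13): file split only (tree files ≤ 400 lines); sections, section `variable`s /
`open`s and every declaration exactly as in the lens (namespace renamed Theses ↦ Theorems, the HOME-only
dupNamespace-linter line dropped; `noncomputable section` and the five file-level `open` lines replayed in every
file). Audit-cone caveat of the lens honoured: each pattern-matching recursive helper
(`isRegular_top_of_weakAdmissible`, `stalkIdeal_transformMarked_of_not_mem`, `WeakAdmissible.restrict`) stays in the
same file as a tactic-style proof referencing it whenever the cap allows; a cut between them changes nothing for the kernel.]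

(Sources: Hironaka1964 Ch. III §§1–3, §7; Giraud1975; CossartJannsenSaito2020 Ch. 2, Ch. 8–9; EGAIV4 §16–§17;
Matsumura1987 §28–§30; CossartPiltant2008 Prop. 4.2; BierstoneMilman1997 §3; Cutkosky2004 Ch. 6–7; Kollar2007 §3;
StacksProject 01WV / 0806 / 080A.)
-/

noncomputable section

open CategoryTheory AlgebraicGeometry IsLocalRing TopologicalSpace Topology
open Literature.AlgebraicGeometry.Resolution
open Summit.ResolutionOfSingularities.ResolutionOfSingularities.Theorems
open Summit.ResolutionOfSingularities.ResolutionOfSingularities.Theorems.WeakOrderReduction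
open Summit.ResolutionOfSingularities.ResolutionOfSingularities.Theorems.FaceFormCutClasses

namespace Summit.ResolutionOfSingularities.ResolutionOfSingularities.Theorems.PortCut

section Transport

/-! ## §T  Transport along a local isomorphism -/

/-- **Orders are transported along a local isomorphism**: if `f.stalkMap x` is an isomorphism carrying the
stalk `𝓘_{f x}` onto `𝓘'_x`, then `ord_x 𝓘' = ord_{f x} 𝓘` (tree `idealOrder_comap_of_isIso_stalkMap`). [folklore] -/
theorem idealOrder_eq_of_isIso_stalkMap {Y Y' : Scheme.{0}} (f : Y' ⟶ Y) (I : Y.IdealSheafData)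
    (I' : Y'.IdealSheafData) {x : Y'} [IsIso (f.stalkMap x)]
    (hI : stalkIdeal I' x = (stalkIdeal I (f x)).map (f.stalkMap x).hom) :
    idealOrder I' x = idealOrder I (f x) := by
  rw [← idealOrder_comap_of_isIso_stalkMap f x I]
  refine ENat.eq_of_forall_natCast_le_iff fun m => ?_
  rw [le_idealOrder_iff, le_idealOrder_iff, hI, ← stalkIdeal_comap_eq_map_stalkMap]

/-- **Hironaka's `τ` is transported along a local isomorphism** (tree `stalkTau_eq_of_isIso_stalkMap` under
`tauAt`). [folklore] -/
theorem tauAt_eq_of_isIso_stalkMap {Y Y' : Scheme.{0}} (f : Y' ⟶ Y) (hY : Scheme.IsRegular Y)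
    (hY' : Scheme.IsRegular Y') (I : Y.IdealSheafData) (I' : Y'.IdealSheafData) (n : ℕ) {x : Y'}
    [IsIso (f.stalkMap x)] (hI : stalkIdeal I' x = (stalkIdeal I (f x)).map (f.stalkMap x).hom) :
    tauAt hY' I' n x = tauAt hY I n (f x) := by
  haveI := hY (f x); haveI := hY' x
  change stalkTau I' x n = stalkTau I (f x) n
  exact stalkTau_eq_of_isIso_stalkMap f x I I' hI n

variable {k : Type} [Field k] {Y Y' : Scheme.{0}} (g : Y ⟶ Spec (.of k))

/-- **Maximal contact is transported along a local isomorphism compatible with the `k`-structures**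
(`f : Y' → Y` over `k`, the `k`-structure of `Y'` being the composite `f ≫ g`): `Diff^{≤ n-1}` of `𝓘'`
at `x` is the image of `Diff^{≤ n-1}(𝓘)_{f x}` under the `k`-algebra isomorphism `𝒪_{Y, f x} ≅ 𝒪_{Y', x}`
(`stalkIdeal_diffIdealSheaf`, `diffIdeal_map_algEquiv`), so maximal contact at `f x` gives maximal contact
at `x` (landed order-free criterion `ExitCut.isContactPt_iff_exists_stalk`).  The landed one-blow-up lemma
`ExitCut.isContactPt_controlledTransform_of_not_mem` is the case `f = π`, `𝓘' = σᶜ(𝓘)` off the centre. [folklore] -/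
theorem isContactPt_of_isIso_stalkMap [LocallyOfFiniteType g] (f : Y' ⟶ Y) [LocallyOfFiniteType (f ≫ g)]
    (I : Y.IdealSheafData) (I' : Y'.IdealSheafData) (n : ℕ) {x : Y'} [IsIso (f.stalkMap x)]
    (hI : stalkIdeal I' x = (stalkIdeal I (f x)).map (f.stalkMap x).hom)
    (h : IsContactPt g I n (f x)) : IsContactPt (f ≫ g) I' n x := by
  rw [ExitCut.isContactPt_iff_exists_stalk] at h ⊢
  obtain ⟨z, hzJ, hz1, hz2⟩ := h
  have hft : HasFiniteTypeSections (ExitCut.kStr g) := hasFiniteTypeSections_of_locallyOfFiniteType k g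
  have hft' : HasFiniteTypeSections (ExitCut.kStr (f ≫ g)) :=
    hasFiniteTypeSections_of_locallyOfFiniteType k (f ≫ g)
  letI algY : Algebra k (Y.presheaf.stalk (f x)) := stalkAlgebra (ExitCut.kStr g) (f x)
  letI algY' : Algebra k (Y'.presheaf.stalk x) := stalkAlgebra (ExitCut.kStr (f ≫ g)) x
  -- the stalk isomorphism is a `k`-algebra isomorphism
  let e0 : Y.presheaf.stalk (f x) ≃+* Y'.presheaf.stalk x := (asIso (f.stalkMap x)).commRingCatIsoToRingEquiv
  have he0 : ∀ w, e0 w = (f.stalkMap x).hom w := fun w => rfl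
  have hcomm : ∀ c : k, e0 (algebraMap k (Y.presheaf.stalk (f x)) c) =
      algebraMap k (Y'.presheaf.stalk x) c := by
    intro c
    rw [he0]
    change (f.stalkMap x).hom ((Y.presheaf.germ ⊤ (f x) trivial).hom (ExitCut.kStr g c)) =
      (Y'.presheaf.germ ⊤ x trivial).hom (ExitCut.kStr (f ≫ g) c)
    rw [Scheme.Hom.germ_stalkMap_apply]
    simp only [ExitCut.kStr, RingHom.coe_comp, Function.comp_apply, Scheme.Hom.comp_appTop, CommRingCat.hom_comp]
    rfl
  let e : Y.presheaf.stalk (f x) ≃ₐ[k] Y'.presheaf.stalk x := AlgEquiv.ofRingEquiv (f := e0) hcomm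
  have hmap : ∀ J : Ideal (Y.presheaf.stalk (f x)), J.map (f.stalkMap x).hom = J.map e := fun J => rfl
  have key : stalkIdeal (diffIdealSheaf (ExitCut.kStr (f ≫ g)) (n - 1) I') x =
      (stalkIdeal (diffIdealSheaf (ExitCut.kStr g) (n - 1) I) (f x)).map e := by
    rw [stalkIdeal_diffIdealSheaf hft', stalkIdeal_diffIdealSheaf hft, hI, hmap, diffIdeal_map_algEquiv e]
  have hm : (maximalIdeal (Y.presheaf.stalk (f x))).map e = maximalIdeal (Y'.presheaf.stalk x) :=
    map_ringEquiv_maximalIdeal e.toRingEquiv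
  refine ⟨e z, ?_, ?_, ?_⟩
  · rw [key]; exact Ideal.mem_map_of_mem e hzJ
  · rw [← hm]; exact Ideal.mem_map_of_mem e hz1
  · intro h2
    apply hz2
    rw [← Ideal.comap_map_of_bijective e e.bijective (I := maximalIdeal _ ^ 2), Ideal.mem_comap,
      Ideal.map_pow, hm]
    exact h2

/-- **Class `≥ j` is transported along a local isomorphism compatible with the `k`-structures** (generalises the
landed one-blow-up lemma `ExitCut.classGE_controlledTransform_of_not_mem`, `Theorems/ExitCutKernels.lean`). [folklore] -/
theorem classGE_of_isIso_stalkMap [LocallyOfFiniteType g] (f : Y' ⟶ Y) [LocallyOfFiniteType (f ≫ g)]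
    (hY : Scheme.IsRegular Y) (hY' : Scheme.IsRegular Y') (I : Y.IdealSheafData) (I' : Y'.IdealSheafData)
    (n j : ℕ) {x : Y'} [IsIso (f.stalkMap x)]
    (hI : stalkIdeal I' x = (stalkIdeal I (f x)).map (f.stalkMap x).hom) (h : ClassGE g hY I n j (f x)) :
    ClassGE (f ≫ g) hY' I' n j x := by
  rcases h with h | h | ⟨hj, hτ⟩
  · exact Or.inl h
  · exact Or.inr (Or.inl (isContactPt_of_isIso_stalkMap g f I I' n hI h))
  · refine Or.inr (Or.inr ⟨hj, ?_⟩)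
    rw [tauAt_eq_of_isIso_stalkMap f hY hY' I I' n hI]
    exact hτ

end Transport

section Seq

/-! ## §S  Sequence kernels under `WeakAdmissible` -/

/-- Unfolding `WeakAdmissible` at a `cons`. [folklore] -/
theorem weakAdmissible_cons {X : Scheme.{0}} (C : X.IdealSheafData) (rest : CentreSeq (blowup C))
    (M : MarkedIdeal X) :
    WeakAdmissible (.cons C rest) M ↔ (C.support : Set X) ⊆ M.support ∧ Scheme.IsRegular C.subscheme ∧
      WeakAdmissible rest (M.transform (blowup.π C) C) := Iff.rfl

/-- **The top of a weakly admissible sequence over a regular scheme is regular** (each blow-up in a regular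
centre of a regular scheme is regular, tree `IsBlowup.isRegular_of_isRegular_subscheme`). [folklore] -/
theorem isRegular_top_of_weakAdmissible : ∀ {X : Scheme.{0}} [IsLocallyNoetherian X] (s : CentreSeq X)
    (M : MarkedIdeal X), Scheme.IsRegular X → WeakAdmissible s M → Scheme.IsRegular s.top
  | _, _, .nil _, _, hX, _ => hX
  | _, _, .cons C rest, M, hX, h => by
    obtain ⟨-, hC, hrest⟩ := (weakAdmissible_cons C rest M).mp h
    haveI := CentreSeq.isLocallyNoetherian_blowup C
    exact isRegular_top_of_weakAdmissible rest _
      (IsBlowup.isRegular_of_isRegular_subscheme hX hC (blowup.isBlowup C)) hrest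

/-- **Order `≤ μ` persists through the blow-up of a regular centre inside the top locus** (tree
`IsBlowup.idealOrder_controlledTransform_le_of_forall`, the centre rewritten as the vanishing ideal of its
support — it is radical since `C.subscheme` is regular, hence reduced). [folklore] -/
theorem idealOrder_controlledTransform_blowup_le {X : Scheme.{0}} [IsLocallyNoetherian X]
    (hX : Scheme.IsRegular X) (C : X.IdealSheafData) (hC : Scheme.IsRegular C.subscheme)
    {J : X.IdealSheafData} {μ : ℕ} (hCJ : ∀ y ∈ (C.support : Set X), idealOrder J y = μ)
    (hJ : ∀ x, idealOrder J x ≤ μ) (x' : blowup C) :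
    idealOrder (controlledTransform (blowup.π C) C J μ) x' ≤ μ := by
  haveI : IsReduced C.subscheme := hC.isReduced
  haveI := CentreSeq.isLocallyNoetherian_blowup C
  obtain ⟨Z, rfl⟩ : ∃ Z : Closeds X, C = Scheme.IdealSheafData.vanishingIdeal Z :=
    ⟨_, eq_vanishingIdeal_support (radical_eq_of_isReduced_subscheme C)⟩
  exact (blowup.isBlowup _).idealOrder_controlledTransform_le_of_forall hX hC
    (fun y hy => hCJ y (by rwa [coe_support_vanishingIdeal])) hJ x'

/-- **Order `≤ μ` persists along a weakly admissible sequence** for `(𝓘, E, μ)` on a regular scheme. [folklore] -/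
theorem idealOrder_transformMarked_le {X : Scheme.{0}} (s : CentreSeq X) :
    ∀ [IsLocallyNoetherian X] (M : MarkedIdeal X), Scheme.IsRegular X → WeakAdmissible s M →
      (∀ x : X, idealOrder M.ideal x ≤ M.mult) →
      ∀ x : s.top, idealOrder (s.transformMarked M).ideal x ≤ M.mult := by
  induction s with
  | nil X => intro _ M _ _ h; exact h
  | cons C rest ih =>
    intro _ M hX hadm h
    obtain ⟨hCsupp, hC, hrest⟩ := (weakAdmissible_cons C rest M).mp hadm
    haveI := CentreSeq.isLocallyNoetherian_blowup C
    have hX₁ : Scheme.IsRegular (blowup C) :=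
      IsBlowup.isRegular_of_isRegular_subscheme hX hC (blowup.isBlowup C)
    have h₁ : ∀ x' : blowup C, idealOrder (M.transform (blowup.π C) C).ideal x' ≤
        (M.transform (blowup.π C) C).mult := fun x' =>
      idealOrder_controlledTransform_blowup_le hX C hC (fun y hy => le_antisymm (h y) (hCsupp hy)) h x'
    exact ih _ hX₁ hrest h₁

/-- **The transform OFF the set the centres lie over**: if all centres of `s` lie over `T` and `s.comp x ∉ T`,
the stalk at `x` of the transformed ideal is the stalk of the total pull-back `(s.comp)^* 𝓘` (tree
`IsBlowup.stalkIdeal_controlledTransform_of_not_mem` at every step). [folklore] -/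
theorem stalkIdeal_transformMarked_of_not_mem : ∀ {X : Scheme.{0}} (s : CentreSeq X) (M : MarkedIdeal X)
    {T : Set X}, s.CentresOver T → ∀ x : s.top, s.comp x ∉ T →
      stalkIdeal (s.transformMarked M).ideal x = stalkIdeal (M.ideal.comap s.comp) x
  | _, .nil X, M, _, _, x, _ => by
    change stalkIdeal M.ideal x = stalkIdeal (M.ideal.comap (𝟙 X)) x
    rw [Scheme.IdealSheafData.comap_id]
  | _, .cons C rest, M, T, h, x, hx => by
    obtain ⟨hCT, hrest⟩ := (CentreSeq.centresOver_cons C rest T).mp h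
    have hx' : rest.comp x ∉ blowup.π C ⁻¹' T := hx
    have hxC : blowup.π C (rest.comp x) ∉ (C.support : Set _) := fun hm => hx' (hCT hm)
    have ih := stalkIdeal_transformMarked_of_not_mem rest (M.transform (blowup.π C) C) hrest x hx'
    refine ih.trans ?_
    rw [MarkedIdeal.transform_ideal, stalkIdeal_comap_eq_map_stalkMap,
      (blowup.isBlowup C).stalkIdeal_controlledTransform_of_not_mem _ _ hxC,
      ← stalkIdeal_comap_eq_map_stalkMap, ← Scheme.IdealSheafData.comap_comp]
    rfl

/-- The same, in the `map (stalkMap)` form consumed by §T. [folklore] -/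
theorem stalkIdeal_transformMarked_eq_map_of_not_mem {X : Scheme.{0}} (s : CentreSeq X) (M : MarkedIdeal X)
    {T : Set X} (h : s.CentresOver T) (x : s.top) (hx : s.comp x ∉ T) :
    stalkIdeal (s.transformMarked M).ideal x = (stalkIdeal M.ideal (s.comp x)).map (s.comp.stalkMap x).hom := by
  rw [stalkIdeal_transformMarked_of_not_mem s M h x hx, stalkIdeal_comap_eq_map_stalkMap]

/-- **The transform restricted to an open OFF the set the centres lie over is the pull-back**: for
`ι : W → X_r` with `s.comp (ι w) ∉ T` for all `w`, `ι^*(𝓘_r) = (ι ≫ s.comp)^* 𝓘`. [folklore] -/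
theorem comap_transformMarked_of_forall_not_mem {X W : Scheme.{0}} (s : CentreSeq X) (M : MarkedIdeal X)
    {T : Set X} (h : s.CentresOver T) (ι : W ⟶ s.top) (hι : ∀ w : W, s.comp (ι w) ∉ T) :
    (s.transformMarked M).ideal.comap ι = M.ideal.comap (ι ≫ s.comp) := by
  refine ext_of_forall_stalkIdeal_eq fun w => ?_
  rw [Scheme.IdealSheafData.comap_comp, stalkIdeal_comap_eq_map_stalkMap, stalkIdeal_comap_eq_map_stalkMap,
    stalkIdeal_transformMarked_of_not_mem s M h (ι w) (hι w)]

/-- **Restriction of a weakly admissible sequence to an open is weakly admissible** for the restricted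
marked ideal (the snc-free twin of the tree's `IsAdmissibleFor.restrict`: `Scheme.IdealSheafData.support_comap`,
`MarkedIdeal.support_comap_of_etale`, `Scheme.IsRegular.subscheme_comap_of_isOpenImmersion`,
`MarkedIdeal.transform_comap_of_flat`). [folklore] -/
theorem WeakAdmissible.restrict : ∀ {X U : Scheme.{0}} [IsLocallyNoetherian X] (s : CentreSeq X)
    (j : U ⟶ X) [IsOpenImmersion j] (M : MarkedIdeal X), WeakAdmissible s M →
      WeakAdmissible (s.restrict j) (M.comap j)
  | _, _, _, .nil _, _, _, _, _ => trivial
  | X, U, _, .cons C rest, j, _, M, h => by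
    haveI : IsLocallyNoetherian U := LocallyOfFiniteType.isLocallyNoetherian j
    haveI : IsLocallyNoetherian (blowup C) := CentreSeq.isLocallyNoetherian_blowup C
    haveI : IsLocallyNoetherian (blowup (C.comap j)) := CentreSeq.isLocallyNoetherian_blowup (C.comap j)
    obtain ⟨hsupp, hC, hrest⟩ := (weakAdmissible_cons C rest M).mp h
    refine (weakAdmissible_cons (C.comap j) _ _).mpr ⟨?_,
      Scheme.IsRegular.subscheme_comap_of_isOpenImmersion j hC, ?_⟩
    · intro u hu
      rw [Scheme.IdealSheafData.support_comap] at hu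
      change u ∈ (⟨M.ideal.comap j, M.boundary.map (·.comap j), M.mult⟩ : MarkedIdeal U).support
      rw [MarkedIdeal.support_comap_of_etale]
      exact hsupp hu
    · have e := MarkedIdeal.transform_comap_of_flat j (s := blowup.map C j) (π := blowup.π C)
        (π' := blowup.π (C.comap j)) (blowup.map_π C j) M C
      change WeakAdmissible (rest.restrict (blowup.map C j))
        ((⟨M.ideal.comap j, M.boundary.map (·.comap j), M.mult⟩ : MarkedIdeal U).transform
          (blowup.π (C.comap j)) (C.comap j))
      rw [e]
      exact WeakAdmissible.restrict rest (blowup.map C j) (M.transform (blowup.π C) C) hrest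

end Seq

end Summit.ResolutionOfSingularities.ResolutionOfSingularities.Theorems.PortCut
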